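import Summits.ABC.StewartYu.PadicG3Functions
import HarnessLib

/-!
# Cell abc-stewartyu, crux `Y07Odd` (stmt-ABC-19658), line `gen3-slab-odd`: the class functions II — jets controlled by values
# (no loss), sizes at the nodes, and the `f − φ` comparison

`Summits/ABC/StewartYu/PadicG3FunctionsB.lean` — sequel to `PadicG3Functions.lean` (cell `abc-stewartyu`, seat p2-g4, F-odd lead;
design HOME/p2/SETUP3-SPEC.md + HANDOFF addendum 2026-08-27T00:05Z).  Theorems on `G3Setup`; no named fact.  Odd-`p` twin of the
second half of p3-g5's `PadicG3TwoFunctions.lean`, on the big disc `‖z‖ < p^m √p` of the slab: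

* `contDiffAt_g3F`, `deriv_g3F_eventuallyEq`, `iteratedDeriv_g3F_succ`;
* **`norm_iteratedDeriv_g3F_le_of_forall`** — if `‖f_τ'(a)‖ ≤ ε` for `|τ'| ≤ N` then `‖f_τ^{(k)}(a)‖ ≤ ε` for `|τ| + k ≤ N`
  (all ODE coefficients have norm `≤ 1`): the input of the Schwarz step, WITHOUT LOSS although the radius is `p^m √p`;
* `norm_g3F_le_of_node` — size at a point of the unit disc; **`norm_g3F_sub_g3Φ_le`** — the `f − φ` comparison at a point of the
  unit disc: `‖f_τ(z) − φ_τ(z)‖ ≤ Q·‖Λ/b_{j₀}‖` (Yu 2013 Lemma 5.1; `E v − Lsum v = −v_{j₀}·Λ/b_{j₀}`).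

WHAT THIS IS NOT: no Schwarz step (`PadicG3KStep`), no series (`PadicG3Series`); no crux moves.

References: P. L. Cijsouw, M. Waldschmidt, Compositio 34 (1977) §4 (11); K. Yu, Acta Math. 211 (2013), Lemma 5.1; Nesterenko 2003 (4.16).
-/

noncomputable section

open NormedSpace Finset IsUltrametricDist Polynomial Metric Filter
open Literature.NumberTheory.Transcendental
open Literature.NumberTheory.Transcendental.CW77.Setup (Tau tauNorm bumpτ tauNorm_bumpτ)
open scoped Nat Topology

namespace Summit.ABC.StewartYu

namespace G3Setup

variable {p : ℕ} [Fact p.Prime] (S : G3Setup p) {ι : Type*} (R : ι → ℚ[X]) (v : ι → Fin S.n → ℤ)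

/-- `z ↦ (hw i t₀)(z)` is smooth. [folklore] -/
theorem contDiffAt_hw (i : ι) (t₀ : ℕ) (n : WithTop ℕ∞) (z : ℚ_[p]) :
    ContDiffAt ℚ_[p] n (fun w => (hw (p := p) R i t₀).eval w) z := by
  have hc := (Polynomial.contDiff_aeval (𝕜 := ℚ_[p]) (hw (p := p) R i t₀) n).contDiffAt (x := z)
  have e : (fun w : ℚ_[p] => (hw (p := p) R i t₀).eval w) = fun w => Polynomial.aeval w (hw (p := p) R i t₀) := by
    funext w; rw [Polynomial.coe_aeval_eq_eval]
  rw [e]; exact hc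

/-- `f_τ` is smooth at every point of the big disc. [folklore] -/
theorem contDiffAt_g3F (m : ℕ) (B : Finset ι) (hB : ∀ i ∈ B, ‖S.E (v i)‖ ≤ (p : ℝ)⁻¹ ^ (m + 1)) (pv : ι → ℤ)
    (τ : Tau S.n) (n : WithTop ℕ∞) {z : ℚ_[p]} (hz : ‖z‖ < (p : ℝ) ^ m * Real.sqrt p) :
    ContDiffAt ℚ_[p] n (S.g3F R v B pv τ) z := by
  unfold g3F g3termF
  refine ContDiffAt.sum fun i hi => contDiffAt_const.mul ?_
  exact ((contDiffAt_hw (p := p) R i τ.1 n z).mul contDiffAt_const).mul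
    (S.analyticAt_exp_mul_depth m (hB i hi) hz).contDiffAt

/-- `deriv f_τ = Σᵢ cᵢ(τ) f_{τ+eᵢ}` near every point of the big disc. [cite: CijsouwWaldschmidt1977, §4 (p. 188)] -/
theorem deriv_g3F_eventuallyEq (m : ℕ) (B : Finset ι) (hB : ∀ i ∈ B, ‖S.E (v i)‖ ≤ (p : ℝ)⁻¹ ^ (m + 1)) (pv : ι → ℤ)
    (τ : Tau S.n) {a : ℚ_[p]} (ha : ‖a‖ < (p : ℝ) ^ m * Real.sqrt p) :
    deriv (S.g3F R v B pv τ) =ᶠ[𝓝 a]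
      fun z => ∑ i : Fin (S.n + 1), S.g3coef τ i * S.g3F R v B pv (bumpτ τ i) z := by
  have hball : {z : ℚ_[p] | ‖z‖ < (p : ℝ) ^ m * Real.sqrt p} ∈ 𝓝 a := by
    have : {z : ℚ_[p] | ‖z‖ < (p : ℝ) ^ m * Real.sqrt p} = Metric.ball 0 ((p : ℝ) ^ m * Real.sqrt p) := by
      ext z; simp
    rw [this]
    exact Metric.isOpen_ball.mem_nhds (by simpa using ha)
  filter_upwards [hball] with z hz using (S.hasDerivAt_g3F R v m B hB pv τ hz).deriv

/-- **The iterated derivatives**: `f_τ^{(k+1)}(a) = Σᵢ cᵢ(τ) f_{τ+eᵢ}^{(k)}(a)` on the big disc.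
[cite: CijsouwWaldschmidt1977, §4 (11) (p. 189)] -/
theorem iteratedDeriv_g3F_succ (m : ℕ) (B : Finset ι) (hB : ∀ i ∈ B, ‖S.E (v i)‖ ≤ (p : ℝ)⁻¹ ^ (m + 1)) (pv : ι → ℤ)
    (τ : Tau S.n) {a : ℚ_[p]} (ha : ‖a‖ < (p : ℝ) ^ m * Real.sqrt p) (k : ℕ) :
    iteratedDeriv (k + 1) (S.g3F R v B pv τ) a =
      ∑ i : Fin (S.n + 1), S.g3coef τ i * iteratedDeriv k (S.g3F R v B pv (bumpτ τ i)) a := by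
  rw [iteratedDeriv_succ', (S.deriv_g3F_eventuallyEq R v m B hB pv τ ha).iteratedDeriv_eq k,
    iteratedDeriv_fun_sum fun i _ =>
      contDiffAt_const.mul (S.contDiffAt_g3F R v m B hB pv (bumpτ τ i) k ha)]
  refine sum_congr rfl fun i _ => ?_
  exact iteratedDeriv_const_mul _ (S.contDiffAt_g3F R v m B hB pv (bumpτ τ i) k ha)

/-- **Derivatives are controlled by values, without loss** (the slab keeps all coefficients of norm `≤ 1`): if
`‖f_τ'(a)‖ ≤ ε` whenever `|τ'| ≤ N`, then `‖f_τ^{(k)}(a)‖ ≤ ε` whenever `|τ| + k ≤ N`.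
[cite: CijsouwWaldschmidt1977, §4 (11) (p. 189)] [cite: Yu1990, Lemma 2.4] -/
theorem norm_iteratedDeriv_g3F_le_of_forall (m : ℕ) (B : Finset ι) (hB : ∀ i ∈ B, ‖S.E (v i)‖ ≤ (p : ℝ)⁻¹ ^ (m + 1))
    (pv : ι → ℤ) {a : ℚ_[p]} (ha : ‖a‖ < (p : ℝ) ^ m * Real.sqrt p) (N : ℕ) {ε : ℝ} (hε0 : 0 ≤ ε)
    (hε : ∀ τ : Tau S.n, tauNorm τ ≤ N → ‖S.g3F R v B pv τ a‖ ≤ ε) :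
    ∀ (k : ℕ) (τ : Tau S.n), tauNorm τ + k ≤ N → ‖iteratedDeriv k (S.g3F R v B pv τ) a‖ ≤ ε := by
  intro k
  induction k with
  | zero => intro τ hτ; simpa using hε τ (by simpa using hτ)
  | succ k ih =>
    intro τ hτ
    rw [S.iteratedDeriv_g3F_succ R v m B hB pv τ ha k]
    refine IsUltrametricDist.norm_sum_le_of_forall_le_of_nonneg hε0 fun i _ => ?_
    rw [norm_mul]
    refine (mul_le_of_le_one_left (norm_nonneg _) (S.norm_g3coef_le τ i)).trans (ih _ ?_)
    rw [tauNorm_bumpτ]; omega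

/-! ### Sizes at the nodes and the `f − φ` comparison -/

/-- `‖E v · z‖ ≤ p⁻¹` on the unit disc (depth `m+1 ≥ 1`). [folklore] -/
theorem norm_E_mul_le (m : ℕ) {w : Fin S.n → ℤ} (hw' : ‖S.E w‖ ≤ (p : ℝ)⁻¹ ^ (m + 1)) {z : ℚ_[p]} (hz : ‖z‖ ≤ 1) :
    ‖S.E w * z‖ ≤ (p : ℝ)⁻¹ := by
  rw [norm_mul]
  calc ‖S.E w‖ * ‖z‖ ≤ (p : ℝ)⁻¹ * 1 := mul_le_mul (S.norm_le_inv_p_of_depth m hw') hz (norm_nonneg _) (inv_nonneg.mpr S.p_pos.le)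
    _ = (p : ℝ)⁻¹ := mul_one _

/-- `‖Lsum v · z‖ ≤ p⁻¹` on the unit disc. [folklore] -/
theorem norm_Lsum_mul_le (w : Fin S.n → ℤ) {z : ℚ_[p]} (hz : ‖z‖ ≤ 1) : ‖S.Lsum w * z‖ ≤ (p : ℝ)⁻¹ := by
  rw [norm_mul]
  calc ‖S.Lsum w‖ * ‖z‖ ≤ (p : ℝ)⁻¹ * 1 := mul_le_mul (S.norm_Lsum_le w) hz (norm_nonneg _) (inv_nonneg.mpr S.p_pos.le)
    _ = (p : ℝ)⁻¹ := mul_one _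

/-- **Size of `f_τ` at a point of the unit disc**: `‖f_τ(z)‖ ≤ Q` if `‖(Hasse_{t₀} Rᵢ)(z)‖ ≤ Q` on `B`.
[cite: Yu1990, Lemma 2.2] -/
theorem norm_g3F_le_of_node (m : ℕ) (B : Finset ι) (hB : ∀ i ∈ B, ‖S.E (v i)‖ ≤ (p : ℝ)⁻¹ ^ (m + 1)) (pv : ι → ℤ)
    (τ : Tau S.n) {z : ℚ_[p]} (hz : ‖z‖ ≤ 1) {Q : ℝ} (hQ0 : 0 ≤ Q) (hQ : ∀ i ∈ B, ‖(hw (p := p) R i τ.1).eval z‖ ≤ Q) :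
    ‖S.g3F R v B pv τ z‖ ≤ Q := by
  have hp2 : p ≠ 2 := by have := S.hp3; omega
  unfold g3F
  refine IsUltrametricDist.norm_sum_le_of_forall_le_of_nonneg hQ0 fun i hi => ?_
  unfold g3termF
  rw [norm_mul, norm_mul, norm_mul, PadicExpOdd.norm_exp_of_le (ℓ := p) hp2 (S.norm_E_mul_le m (hB i hi) hz), mul_one]
  calc ‖(pv i : ℚ_[p])‖ * (‖(hw (p := p) R i τ.1).eval z‖ * ‖(S.zγpow v i τ.2 : ℚ_[p])‖) ≤ 1 * (Q * 1) := by
        refine mul_le_mul (Padic.norm_int_le_one _) ?_ (by positivity) zero_le_one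
        exact mul_le_mul (hQ i hi) (S.norm_zγpow_le v i τ.2) (norm_nonneg _) hQ0
    _ = Q := by ring

/-- **The `f − φ` comparison at a point of the unit disc** (Yu 2013 Lemma 5.1 / Cijsouw–Waldschmidt Lemma 9, ultrametric):
if `‖Λ/b_{j₀}‖ ≤ p⁻¹` then `‖f_τ(z) − φ_τ(z)‖ ≤ Q·‖Λ/b_{j₀}‖`, since `E v − Lsum v = −v_{j₀}Λ/b_{j₀}` and
`‖exp w − 1‖ = ‖w‖`. [cite: Yu2013, Lemma 5.1] -/
theorem norm_g3F_sub_g3Φ_le (B : Finset ι) (pv : ι → ℤ)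
    (τ : Tau S.n) {z : ℚ_[p]} (hz : ‖z‖ ≤ 1) (hΛ : ‖S.Λ / (S.b S.j₀ : ℚ_[p])‖ ≤ (p : ℝ)⁻¹)
    {Q : ℝ} (hQ0 : 0 ≤ Q) (hQ : ∀ i ∈ B, ‖(hw (p := p) R i τ.1).eval z‖ ≤ Q) :
    ‖S.g3F R v B pv τ z - S.g3Φ R v B pv τ z‖ ≤ Q * ‖S.Λ / (S.b S.j₀ : ℚ_[p])‖ := by
  have hp2 : p ≠ 2 := by have := S.hp3; omega
  unfold g3F g3Φ
  rw [← sum_sub_distrib]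
  refine IsUltrametricDist.norm_sum_le_of_forall_le_of_nonneg (by positivity) fun i hi => ?_
  -- the correction `δ := −v_{j₀} Λ/b_{j₀} · z`, `E v z = Lsum v z + δ`
  set δ : ℚ_[p] := -((v i S.j₀ : ℚ_[p]) * (S.Λ / (S.b S.j₀ : ℚ_[p])) * z) with hδdef
  have hsplit : S.E (v i) * z = S.Lsum (v i) * z + δ := by
    rw [hδdef]; unfold E; ring
  have hδ : ‖δ‖ ≤ ‖S.Λ / (S.b S.j₀ : ℚ_[p])‖ := by
    rw [hδdef, norm_neg, norm_mul, norm_mul]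
    calc ‖(v i S.j₀ : ℚ_[p])‖ * ‖S.Λ / (S.b S.j₀ : ℚ_[p])‖ * ‖z‖ ≤ 1 * ‖S.Λ / (S.b S.j₀ : ℚ_[p])‖ * 1 := by
          refine mul_le_mul (mul_le_mul_of_nonneg_right (Padic.norm_int_le_one _) (norm_nonneg _)) hz
            (norm_nonneg _) (by positivity)
      _ = _ := by ring
  have hδp : ‖δ‖ ≤ (p : ℝ)⁻¹ := hδ.trans hΛ
  have hL := S.norm_Lsum_mul_le (v i) hz
  have e : (pv i : ℚ_[p]) * S.g3termF R v i τ z - (pv i : ℚ_[p]) * S.g3termΦ R v i τ z =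
      (pv i : ℚ_[p]) * ((hw (p := p) R i τ.1).eval z * (S.zγpow v i τ.2 : ℚ_[p]) * exp (S.Lsum (v i) * z)) *
        (exp δ - 1) := by
    simp only [g3termF, g3termΦ]
    rw [hsplit, PadicExp.exp_add_of_norm_le (ℓ := p) S.hp3 hL hδp]
    ring
  rw [e, norm_mul, norm_mul, norm_mul, norm_mul, PadicExpOdd.norm_exp_of_le (ℓ := p) hp2 hL, mul_one,
    PadicExpOdd.norm_exp_sub_one_of_le (ℓ := p) hp2 hδp]
  calc ‖(pv i : ℚ_[p])‖ * (‖(hw (p := p) R i τ.1).eval z‖ * ‖(S.zγpow v i τ.2 : ℚ_[p])‖) * ‖δ‖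
      ≤ 1 * (Q * 1) * ‖S.Λ / (S.b S.j₀ : ℚ_[p])‖ := by
        refine mul_le_mul ?_ hδ (norm_nonneg _) (by positivity)
        refine mul_le_mul (Padic.norm_int_le_one _) ?_ (by positivity) zero_le_one
        exact mul_le_mul (hQ i hi) (S.norm_zγpow_le v i τ.2) (norm_nonneg _) hQ0
    _ = Q * ‖S.Λ / (S.b S.j₀ : ℚ_[p])‖ := by ring

end G3Setup

end Summit.ABC.StewartYu

end
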